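import Mathlib
import Literature.Combinatorics.Optimization.ThreeSatThreeXorSosGaps
import Literature.Combinatorics.Optimization.MaxThreeSatSdpLowerBound
import Literature.Combinatorics.Optimization.PsdRankLowerBoundsUnconditional

/-!
# Max-3SAT / Max-3XOR: the SDP and LP/Sherali–Adams gap theorems, now unconditional

Sink module (composition only; imported by nothing upstream).  With
`Schoenebeck2008_maxThreeSatSos_holds` and `Schoenebeck2008_maxThreeXorSA_holds`
(`ThreeSatThreeXorSosGaps.lean`) and `LeeRaghavendraSteurer2015_thm38_holds` /
`LeeRaghavendraSteurer2015_thm16_holds` (`PsdRankLowerBoundsUnconditional.lean`) every hypothesis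
of the following tree reductions is a theorem, and we record the resulting UNCONDITIONAL statements:

* `LeeRaghavendraSteurer2015_thm15_approx` — **Lee–Raghavendra–Steurer 2015, Theorem 1.5 in the
  form its printed proof delivers** (no SDP relaxation of size `n^{α log n / log log n}` achieves a
  `(c,s)`-approximation of Max 3-Sat, `7/8 < s < c < 1`), from
  `LeeRaghavendraSteurer2015_thm38.maxThreeSat_quasipoly`;
* `LeeRaghavendraSteurer2015_maxThreeSat_poly` — "polynomial-size SDP relaxations for Max 3-Sat
  cannot achieve an approximation ratio better than `7/8`" (p. 6), from
  `LeeRaghavendraSteurer2015_thm16.maxThreeSat_poly`;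
* `KothariMekaRaghavendra2017_thm75_threeSat` — KMR Thm 7.5 / Thm 1.4 for Max-3SAT (linear-round
  Sherali–Adams does not beat `7/8`), from `Schoenebeck2008_maxThreeSatSos.not_saAchieves`;
* `KothariMekaRaghavendra2017_cor15_threeSat_of_thm110'`, `_cor15_threeXor_of_thm110'` — KMR
  Cor. 1.5 (3SAT, 3XOR) now rest on the single engine fact `KothariMekaRaghavendra2017_thm110`;
* `Grigoriev2001_maxThreeXorSos` — **Grigoriev's theorem in the Max-CSP currency** (FKP19
  Thm 5.2 with Lemma 5.3): for every `ε > 0` there are `c_ε > 0`, `n₀` with, for all `n ≥ n₀`, a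
  Max-3XOR instance on `n` variables with `opt ≤ 1/2 + ε` and no degree-`⌊c_ε n⌋` sum-of-squares
  certificate of `c − ℑ` for any `c < 1` — PROVED (same assembly as the 3SAT discharge).

No definitions, no named facts.

## References

* J. R. Lee, P. Raghavendra, D. Steurer, STOC 2015 / arXiv:1411.6317, Thm 1.5, Thm 1.6 and p. 6,
  Thm 6.5 (p. 26) [LeeRaghavendraSteurer2015].
* P. Kothari, R. Meka, P. Raghavendra, STOC 2017 / arXiv:1610.02704, Thm 1.4, Cor. 1.5 (p. 4),
  Thm 7.5 (p. 21) [KothariMekaRaghavendra2017].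
* N. Fleming, P. Kothari, T. Pitassi, Found. Trends TCS 14 (2019), §5.1, Thm 5.2
  [FlemingKothariPitassi2019]; D. Grigoriev, Theoret. Comput. Sci. 259 (2001) [Grigoriev2001TCS].
-/

noncomputable section

open Finset
open Literature.Probability.RandomGraphs.LowDegree (walsh)
open Literature.Computability.Complexity (kClauses)
open Literature.Computability.MetaComplexity (clauseScope IsCoverExpander)

namespace Literature.Combinatorics.Optimization

/-- **Lee–Raghavendra–Steurer 2015, Theorem 1.5 (the form its printed proof delivers) —
UNCONDITIONAL:** there is `α > 0` such that for all `7/8 < s < c < 1` and all large `n`, no subspace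
`U` of functions on `{0,1}ⁿ` with `dim U ≤ n^{α log n / log log n}` achieves a `(c,s)`-approximation
for Max 3-Sat. [cite: LeeRaghavendraSteurer2015, Thm 1.5 (p. 6) and its proof (p. 26–27)] -/
theorem LeeRaghavendraSteurer2015_thm15_approx :
    ∃ α : ℝ, 0 < α ∧ ∀ s : ℝ, 7 / 8 < s → ∀ c : ℝ, s < c → c < 1 →
      ∃ n₀ : ℕ, ∀ n : ℕ, n₀ ≤ n → ∀ U : Submodule ℝ ((Fin n → Bool) → ℝ),
        (Module.finrank ℝ U : ℝ) ≤ (n : ℝ) ^ (α * Real.log n / Real.log (Real.log n)) →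
        ¬ AchievesApprox maxThreeSatPreds (U : Set ((Fin n → Bool) → ℝ)) c s :=
  LeeRaghavendraSteurer2015_thm38.maxThreeSat_quasipoly LeeRaghavendraSteurer2015_thm38_holds
    Schoenebeck2008_maxThreeSatSos_holds

/-- **"Polynomial-size SDP relaxations for Max 3-Sat cannot achieve an approximation ratio better
than `7/8`" — UNCONDITIONAL:** for all `s > 7/8`, `c < 1`, `C ∈ ℕ` and all large `n`, no subspace
`U` with `dim U ≤ n^C` achieves a `(c,s)`-approximation for Max 3-Sat on `n` variables.
[cite: LeeRaghavendraSteurer2015, Thm 1.6 and the paragraph following it (p. 6)] -/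
theorem LeeRaghavendraSteurer2015_maxThreeSat_poly :
    ∀ s : ℝ, 7 / 8 < s → ∀ c : ℝ, c < 1 → ∀ C : ℕ, ∃ n₀ : ℕ, ∀ n : ℕ, n₀ ≤ n →
      ∀ U : Submodule ℝ ((Fin n → Bool) → ℝ), (Module.finrank ℝ U : ℝ) ≤ (n : ℝ) ^ C →
        ¬ AchievesApprox maxThreeSatPreds (U : Set ((Fin n → Bool) → ℝ)) c s :=
  LeeRaghavendraSteurer2015_thm16_holds.maxThreeSat_poly Schoenebeck2008_maxThreeSatSos_holds

/-- **Kothari–Meka–Raghavendra 2017, Thm 7.5 = Thm 1.4 for Max-3SAT — UNCONDITIONAL:** for every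
`ε > 0` there are `c_ε > 0`, `n₀` such that for all `n ≥ n₀`, all `d` with `2d ≤ ⌊c_ε n⌋` and all
`c < 1`, degree-`d` Sherali–Adams fails to achieve a `(c, 7/8 + ε)`-approximation for Max-3SAT on
`n` variables. [cite: KothariMekaRaghavendra2017, Thm 7.5 (p. 21) and Thm 1.4 (p. 4)] -/
theorem KothariMekaRaghavendra2017_thm75_threeSat {ε : ℝ} (hε : 0 < ε) :
    ∃ cε : ℝ, 0 < cε ∧ ∃ n₀ : ℕ, ∀ n : ℕ, n₀ ≤ n → ∀ d : ℕ, 2 * d ≤ ⌊cε * n⌋₊ →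
      ∀ c : ℝ, c < 1 → ¬ SAAchieves (n := n) maxThreeSatPreds d c (7 / 8 + ε) :=
  Schoenebeck2008_maxThreeSatSos.not_saAchieves Schoenebeck2008_maxThreeSatSos_holds hε

/-- **KMR Corollary 1.5 (MAX-3SAT) from Theorem 1.10 alone.** [cite: KothariMekaRaghavendra2017, Cor. 1.5 (p. 4)] -/
theorem KothariMekaRaghavendra2017_cor15_threeSat_of_thm110'
    (h110 : KothariMekaRaghavendra2017_thm110) : KothariMekaRaghavendra2017_cor15_threeSat :=
  KothariMekaRaghavendra2017_cor15_threeSat_of_thm110 h110 Schoenebeck2008_maxThreeSatSos_holds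

/-- **KMR Corollary 1.5 (MAX-3XOR) from Theorem 1.10 alone.** [cite: KothariMekaRaghavendra2017, Cor. 1.5 (p. 4)] -/
theorem KothariMekaRaghavendra2017_cor15_threeXor_of_thm110'
    (h110 : KothariMekaRaghavendra2017_thm110) : KothariMekaRaghavendra2017_cor15_threeXor :=
  KothariMekaRaghavendra2017_cor15_threeXor_of_thm110 h110 Schoenebeck2008_maxThreeXorSA_holds

/-- **Grigoriev 2001 / Schoenebeck 2008 for Max-3XOR in the Max-CSP currency (FKP19 Thm 5.2 with
Lemma 5.3) — PROVED:** for every `ε > 0` there are `c_ε > 0` and `n₀` such that for every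
`n ≥ n₀` some Max-3XOR instance `ℑ` on `n` variables has `opt(ℑ) ≤ 1/2 + ε` while for every
`c < 1` the function `c − ℑ` has no degree-`⌊c_ε n⌋` sum-of-squares certificate ("`φ` is
`(1/2 + ε)`-unsatisfiable and requires SoS refutations of degree `Ω(n)`").
[cite: FlemingKothariPitassi2019, §5.1 (Thm 5.2, Lemma 5.3, pp. 147–148)] -/
theorem Grigoriev2001_maxThreeXorSos :
    ∀ ε : ℝ, 0 < ε → ∃ cε : ℝ, 0 < cε ∧ ∃ n₀ : ℕ, ∀ n : ℕ, n₀ ≤ n →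
      ∃ I : CSPInstance 3 n (literalClosure xorThree), I.OptLE (1 / 2 + ε) ∧
        ∀ c : ℝ, c < 1 → ¬ HasSosCertificate ⌊cε * n⌋₊ (fun x => c - I.val x) := by
  intro ε hε
  classical
  set ε' : ℝ := min ε 1 with hε'
  have hε'0 : 0 < ε' := lt_min hε one_pos
  have hε'1 : ε' ≤ 1 := min_le_right _ _
  have hε'ε : ε' ≤ ε := min_le_left _ _
  obtain ⟨Δ, hΔ, κ, hκ, n₀, H⟩ := exists_good_tuple hε'0 hε'1
  refine ⟨κ / 32, by positivity, max n₀ ⌈128 / κ⌉₊, fun n hn => ?_⟩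
  have hn₀ : n₀ ≤ n := le_of_max_le_left hn
  have hκn : 128 ≤ κ * n := by
    have h1 : (⌈128 / κ⌉₊ : ℝ) ≤ n := by exact_mod_cast le_of_max_le_right hn
    have h2 : 128 / κ ≤ n := (Nat.le_ceil _).trans h1
    rwa [div_le_iff₀ hκ, mul_comm] at h2
  obtain ⟨hN2, hd2, hdN⟩ := degree_bookkeeping hκ (by linarith)
  obtain ⟨ω, hexp, -, hxor⟩ := H n hn₀
  have hn1 : 1 ≤ n := by
    by_contra h; push Not at h
    have : n = 0 := by omega
    rw [this] at hκn; simp at hκn; linarith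
  have hm : 0 < Δ * n := Nat.mul_pos (by omega) (by omega)
  set d : ℕ := ⌊κ / 32 * n⌋₊ with hddef
  have hd3 : 3 ≤ d := by
    refine Nat.le_floor ?_; push_cast; nlinarith
  have hdle : (d : ℝ) ≤ 1 / 2 * ((⌊κ * n⌋₊ : ℕ) : ℝ) / 2 := by
    have : (d : ℝ) ≤ ((2 * d : ℕ) : ℝ) := by push_cast; linarith
    exact this.trans hdN
  refine ⟨xorInstance ω hm, fun x => ?_, fun c hc hsos => ?_⟩
  · rw [xorInstance_val ω hm x, div_le_iff₀ (by exact_mod_cast hm)]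
    calc _ ≤ (1 / 2 + ε') * (Δ * n : ℕ) := hxor x
      _ ≤ (1 / 2 + ε) * (Δ * n : ℕ) := by push_cast; gcongr
      _ = (1 / 2 + ε) * ((Δ * n : ℕ) : ℝ) := by push_cast; ring
  · have hvec := vecExpands_tupleVecs ω hexp
    have hb : ∀ i, tupleXorSigns ω i * tupleXorSigns ω i = 1 := fun i => xorSign_mul_self _
    have hD := isPseudoDensity_gsDensity (n := n) (b := tupleXorSigns ω) hvec (by norm_num) hdle
      (by linarith) hb
    have h0 := hD.cubeExpect_mul_nonneg hsos
    rw [cubeExpect_mul_sub, cubeExpect_mul_const, hD.1,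
      cubeExpect_gsDensity_mul_xorInstance_val ω hm hexp hN2 hdle hd3] at h0
    linarith

end Literature.Combinatorics.Optimization
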